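import Literature.MathematicalPhysics.QuantumFieldTheory.Balaban1983to89.B8Ineq159FlatCubeMemberPerCube
import Literature.MathematicalPhysics.QuantumFieldTheory.Balaban1983to89.B9SupplySockB9P3ZdGamma

/-!
# `Balaban1983to89.B8Ineq159FlatCubeMemberPerCubeGamma` — the per-cube inhabitant of the repaired flat (1.59) target RE-INDEXED on edition γ's
# datum index: level `0` of print's class `cubeLamBP … m 0` = the INNER level-`0` bonds (`cubeLamB … m 0` = `cubeLamBP' … m 0`) ∪ the bonds
# CROSSING `∂□₀` (`CrossB □₀`), levels `j ≥ 1` unchanged (`cubeLamBP' … m j = cubeLamBP … m j`) — so the A6 inhabitant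
# `B8Ineq159FlatCubeMemberPerCube.exists_B0_ineq159Flat_perCube` reads verbatim on the index `p.2 ∈ cubeLamBP' … m p.1 ∨ (p.1 = 0 ∧ CrossB □₀ p.2)`
# of the flat line γ (dag-n05-e g10, Fγ1–Fγ10) and of dag-n06-b's γ sockets

statement-level skeleton of published theorems with citation tags; proofs where landed; nothing here is a claim about the
Yang–Mills mass gap

`[Balaban1985RegularSpaces]` ("B8", CMP **99** (1985) 75–102) (1.31) p. 82, (1.59) p. 86, (1.62) p. 87, (1.131) p. 99, p. 77 (bond convention);
`[Balaban1984PropagatorsII]` ("B6", CMP **96** (1984) 223–250) (2.3) p. 224 («Λ₀ = Ω₁ᶜ», bonds of a region = at least one end-point in it).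

CITATION HEADER (lean-in-tree rule).  Cell `pub-ymgap` (YM Track A, HUMAN RULING D-0062 ∕ D-0149), DAG node N05 = [B8], width seat
`pub-ymgap-dag-n05-w3` (g0), INTENT-4 (bus 2026-08-27 ≈23:45Z).  WHY: the flat line in edition γ indexes the averaging datum by dag-n06-b's split
class `cubeLamBP'` (p579891) plus the separate disjunct `CrossB □₀` at level `0`; dag-n05-c's `cubeLamBP` (p573921) carries both in one class.  This
file is the dictionary and the re-indexed form of the per-cube inhabitant (p585691), for the per-cube step of the γ crown (ASK-Fγ10).

THE MATHEMATICS (kernel-checked; bookkeeping only).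
* §1 `inBox_of_bondBox_zero` (the level-`0` fine box of a bond is its two end-points), ★ `mem_cubeLamBP_zero_iff_inner_or_crossB` (`L ≥ 1`, `ρ ≥ 1`,
  `1 ≤ m ≤ k`): `c ∈ cubeLamBP … m 0 ↔ c ∈ cubeLamB … m 0 ∨ CrossB □₀ c`, and its γ-named twin ★ `mem_cubeLamBP_zero_iff_cubeLamBP'_or_crossB`.
* §2 `linCovIter_data_of_γindex` (γ-indexed datum bound ⇒ `cubeLamBP`-indexed, all levels), ★★ `exists_B0_ineq159Flat_perCube_γ`.

HONEST SCOPE.  Re-indexing of a landed certificate; no estimate; the constant is member-dependent (NOT print's uniform `B₀(d, L)`); count-neutral;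
N05 NOT discharged; no count claim; one finite `T⁴` programme at fixed `ε`, Bałaban as printed; the YM mass gap (Clay) is NOT proved by any of this —
R4 closes the conditional finite-`𝕋⁴` rung `BalabanLadder.UV` only; nothing continuum ∕ ℝ⁴ ∕ OS.  No `sorry`, no `def`, no `instance`, no `notation`.
Unit `pub-ymgap-dag-n05-w3` (g0), 2026-08-27.
-/

noncomputable section

namespace Literature.MathematicalPhysics.QuantumFieldTheory.Balaban1983to89.B8Ineq159FlatCubeMemberPerCubeGamma

open B7Prop1Explicit B7Prop2Explicit B7Prop1Local
open B7Prop4GeneralLevels (linCovIter)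
open B8Ineq132 (covDerivFwd BondTouches)
open B8Eq140Level (SideTouches)
open B8Eq146AExpansion (iEta)
open B8Eq155JBound (Jcur)
open B8Eq138LandauZd (IsLandau138 covLap)
open B8Eq131Cubes (cube sqLo sqHi inLo inHi)
open B8Eq131CubesAdmissible (cubeFam cubeFam_false_zero)
open B8CubeMemberZd (cubeLamS cubeLamB cubeLam cubeLamS_of_lt mem_cubeLam_zero_iff)
open B8Ineq159FlatCubeMemberPrinted (cubeLamBP cubeLamB_subset_cubeLamBP mem_cubeLamBP_zero_of_crossB)
open B8Ineq159FlatShellModeVacuity (mem_cubeLamB_iff_inner)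
open B9SupplySockB9P3ZdBeta (CrossB)
open B9SupplySockB9P3ZdGamma (cubeLamBP' cubeLamBP'_zero cubeLamBP'_of_ne_zero)
open B8Ineq159FlatCubeMemberKernel (mem_cube_zero_iff inBox_in_zero_iff)
open B8Ineq159FlatCubeMemberPerCube (exists_B0_ineq159Flat_perCube)

export B7Prop1Explicit (Site)

variable {d : ℕ}

/-! ## §1 Level `0` of print's class: inner bonds of `Λ₀` ∪ the bonds crossing `∂□₀` -/

/-- **The level-`0` fine box of a bond is the segment between its two end-points**: a point of `[loK L 0 q, bondHiK L 0 q κ]` lies in any box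
containing `q` and `q + e_κ`. [cite: Balaban1985Averaging, p.24; Balaban1985RegularSpaces, p.77 (bond convention)] -/
theorem inBox_of_bondBox_zero {L : ℕ} {lo hi q x : Site d} {κ : Fin d} (hx : InBox (loK L 0 q) (bondHiK L 0 q κ) x)
    (hq : InBox lo hi q) (hq' : InBox lo hi (q + e κ)) : InBox lo hi x := by
  refine inBox_of_between hq hq' fun i => Or.inl ?_
  have h := hx i
  simp only [loK, bondHiK, pow_zero, one_mul, sub_self, add_zero] at h
  rw [add_e_apply]
  exact h

/-- ★ **LEVEL `0` OF PRINT'S CLASS = INNER BONDS OF `Λ₀` ∪ THE BONDS CROSSING `∂□₀`** ([B6] (2.3) at the truncation `m ≥ 1` of the cube member of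
(1.131), `L ≥ 1`, collar `ρ ≥ 1`, `k ≥ m`): `c ∈ cubeLamBP … m 0` (at least one end in `□₀`, no end in `□₁`) iff `c ∈ cubeLamB … m 0` (both ends in
`Λ₀ = □₀ ∖ □₁`, edition γ's `cubeLamBP' … m 0`) or `CrossB □₀ c` (exactly one end in `□₀`) — dag-n05-c's one-class index vs dag-n06-b's split index.
[cite: Balaban1984PropagatorsII, (2.3) p.224; Balaban1985RegularSpaces, (1.31) p.82, (1.131) p.99, p.77] -/
theorem mem_cubeLamBP_zero_iff_inner_or_crossB {L : ℕ} (hL : 1 ≤ L) (a : Site d) (M : ℕ) {ρ : ℕ} (hρ : 1 ≤ ρ) {k m : ℕ}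
    (hm1 : 1 ≤ m) (hmk : m ≤ k) (c : Site d × Fin d) :
    c ∈ cubeLamBP L a M ρ k m 0 ↔ c ∈ cubeLamB L a M ρ k m 0 ∨ CrossB (cubeFam false L a M ρ k 0) c := by
  have hk : 1 ≤ k := hm1.trans hmk
  constructor
  · rintro ⟨-, hends, hdeep⟩
    obtain ⟨h1, h2⟩ := hdeep (by omega)
    rw [cubeFam_false_zero]
    by_cases hboth : InBox (sqLo L a ρ k 0) (sqHi L a M ρ k 0) c.1 ∧ InBox (sqLo L a ρ k 0) (sqHi L a M ρ k 0) (c.1 + e c.2)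
    · -- both ends in `□₀ ∖ □₁`: an inner bond of `Λ₀`
      left
      have hΛ : ∀ z, InBox (sqLo L a ρ k 0) (sqHi L a M ρ k 0) z → ¬ InBox (inLo L a ρ k 0) (inHi L a M ρ k 0) z →
          z ∈ cubeLamS L a M ρ k m 0 := by
        intro z hz hz'
        rw [cubeLamS_of_lt L a M ρ k (show 0 < m by omega)]
        exact ⟨hz, fun _ => hz'⟩
      refine (mem_cubeLamB_iff_inner hL a M ρ (Nat.zero_le m) hmk c).2 ⟨fun x hx => ?_, hΛ _ hboth.1 h1, hΛ _ hboth.2 h2⟩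
      rw [cubeFam_false_zero]
      exact inBox_of_bondBox_zero hx hboth.1 hboth.2
    · -- exactly one end in `□₀`: a crossing bond
      right
      exact ⟨hends, hboth⟩
  · rintro (h | h)
    · exact cubeLamB_subset_cubeLamBP hL a M ρ (Nat.zero_le m) hmk h
    · exact mem_cubeLamBP_zero_of_crossB hL a M hρ hk m h

/-- ★ **The same dictionary on edition γ's name**: `cubeLamBP … m 0 = cubeLamBP' … m 0 ∪ CrossB □₀` (dag-n06-b's `cubeLamBP' … m 0 = cubeLamB … m 0`),
the form the flat line γ's crown (dag-n05-e Fγ10) consumes by name. [cite: Balaban1984PropagatorsII, (2.3) p.224; Balaban1985RegularSpaces, (1.31) p.82, (1.131) p.99] -/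
theorem mem_cubeLamBP_zero_iff_cubeLamBP'_or_crossB {L : ℕ} (hL : 1 ≤ L) (a : Site d) (M : ℕ) {ρ : ℕ} (hρ : 1 ≤ ρ) {k m : ℕ}
    (hm1 : 1 ≤ m) (hmk : m ≤ k) (c : Site d × Fin d) :
    c ∈ cubeLamBP L a M ρ k m 0 ↔ c ∈ cubeLamBP' L a M ρ k m 0 ∨ CrossB (cubeFam false L a M ρ k 0) c := by
  rw [cubeLamBP'_zero]
  exact mem_cubeLamBP_zero_iff_inner_or_crossB hL a M hρ hm1 hmk c

/-! ## §2 The per-cube inhabitant on edition γ's datum index -/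

/-- **The γ-indexed datum bound implies the `cubeLamBP`-indexed one** (all levels `j ≤ m`): level `0` by `mem_cubeLamBP_zero_iff_inner_or_crossB`
(`cubeLamBP' … m 0 = cubeLamB … m 0`), levels `j ≥ 1` by `cubeLamBP' … m j = cubeLamBP … m j`. [cite: Balaban1985RegularSpaces, (1.31) p.82; Balaban1984PropagatorsII, (2.3) p.224] -/
theorem linCovIter_data_of_γindex {L : ℕ} (hL : 1 ≤ L) (a : Site d) (M : ℕ) {ρ : ℕ} (hρ : 1 ≤ ρ) {k m : ℕ} (hm1 : 1 ≤ m) (hmk : m ≤ k)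
    {F : ℕ → Site d → Fin d → ℂ} {N : ℝ}
    (h : ∀ p : ℕ × (Site d × Fin d), p.1 ≤ m →
      (p.2 ∈ cubeLamBP' L a M ρ k m p.1 ∨ (p.1 = 0 ∧ CrossB (cubeFam false L a M ρ k 0) p.2)) → ‖F p.1 p.2.1 p.2.2‖ ≤ N) :
    ∀ j, j ≤ m → ∀ c ∈ cubeLamBP L a M ρ k m j, ‖F j c.1 c.2‖ ≤ N := by
  intro j hj c hc
  rcases Nat.eq_zero_or_pos j with rfl | hjpos
  · rcases (mem_cubeLamBP_zero_iff_inner_or_crossB hL a M hρ hm1 hmk c).1 hc with h' | h'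
    · exact h (0, c) hj (Or.inl (by rw [cubeLamBP'_zero]; exact h'))
    · exact h (0, c) hj (Or.inr ⟨rfl, h'⟩)
  · exact h (j, c) hj (Or.inl (by rw [cubeLamBP'_of_ne_zero L a M ρ k m (by omega)]; exact hc))

/-- ★★ **THE PER-CUBE INHABITANT OF THE REPAIRED FLAT (1.59) TARGET, DATUM READ ON EDITION γ's INDEX.**  For `d ≥ 2`, `L ≥ 1`, `η > 0`, every cube
datum `(a, M, ρ, k)` with collar `ρ ≥ 1`, every truncation `1 ≤ m ≤ k`, there is `B₀ > 0` such that for every `φ` in the flat Landau gauge of record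
with the support clause and every `N ≥ 0` bounding (i) `(Lʲη)³|J(φ)|` on the bonds of `□_j`, (ii) `‖linCovIter L 1 (iηφ) j c‖` for every bond `c` of
`cubeLamBP' … m j` AND every bond crossing `∂□₀` at level `0` (edition γ's index), (iii) `η|φ|` off the bonds of `□₀`: the three pointwise members of
(1.62) hold on the bonds side-touching `□_j` with constant `B₀` — `B8Ineq159FlatCubeMemberPerCube.exists_B0_ineq159Flat_perCube` re-indexed.  `B₀` is
member-dependent (NOT print's uniform constant). [cite: Balaban1985RegularSpaces, (1.59) p.86, (1.62) p.87, (1.31) p.82, (1.38) p.82, (1.131) p.99; Balaban1984PropagatorsII, (2.3) p.224, (2.11) p.225] -/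
theorem exists_B0_ineq159Flat_perCube_γ (hd2 : 2 ≤ d) {L : ℕ} (hL : 1 ≤ L) {η : ℝ} (hη : 0 < η) (a : Site d) (M : ℕ) {ρ : ℕ}
    (hρ : 1 ≤ ρ) {k m : ℕ} (hm1 : 1 ≤ m) (hmk : m ≤ k) :
    ∃ B₀ : ℝ, 0 < B₀ ∧ ∀ φ : Site d → Fin d → ℂ,
      IsLandau138 L m η (cubeFam false L a M ρ k 0) (cubeLamS L a M ρ k m) (1 : Site d → Fin d → ℂˣ) φ →
      (∀ (y : Site d) (τ : Fin d), (∀ j, j ≤ m → ¬ SideTouches (cubeFam false L a M ρ k j) y τ) → φ y τ = 0) →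
      ∀ N : ℝ, 0 ≤ N →
        (∀ j, j ≤ m → ∀ (y : Site d) (τ : Fin d), BondTouches (cubeFam false L a M ρ k j) y τ →
            ((L : ℝ) ^ j * η) ^ 3 * ‖Jcur η (1 : Site d → Fin d → ℂˣ) φ τ y‖ ≤ N) →
        (∀ p : ℕ × (Site d × Fin d), p.1 ≤ m →
            (p.2 ∈ cubeLamBP' L a M ρ k m p.1 ∨ (p.1 = 0 ∧ CrossB (cubeFam false L a M ρ k 0) p.2)) →
            ‖linCovIter L (1 : Site d → Fin d → ℂˣ) (iEta η φ) p.1 p.2.1 p.2.2‖ ≤ N) →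
        (∀ (y : Site d) (τ : Fin d), ¬ BondTouches (cubeFam false L a M ρ k 0) y τ → η * ‖φ y τ‖ ≤ N) →
        ∀ j, j ≤ m → ∀ (y : Site d) (τ : Fin d), SideTouches (cubeFam false L a M ρ k j) y τ →
          ((L : ℝ) ^ j * η) * ‖φ y τ‖ ≤ B₀ * N ∧
          (∀ ν : Fin d, ((L : ℝ) ^ j * η) ^ 2 *
            ‖covDerivFwd η (1 : Site d → Fin d → ℂˣ) ν (fun z => φ z τ) y‖ ≤ B₀ * N) ∧
          ((L : ℝ) ^ j * η) ^ 3 * ‖covLap η (1 : Site d → Fin d → ℂˣ) (fun z => φ z τ) y‖ ≤ B₀ * N := by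
  obtain ⟨B₀, hB₀, H⟩ := exists_B0_ineq159Flat_perCube hd2 hL hη a M ρ hm1 hmk
  refine ⟨B₀, hB₀, fun φ hLan hs N hN h1 h2 h3 => H φ hLan hs N hN h1 ?_ h3⟩
  exact linCovIter_data_of_γindex hL a M hρ hm1 hmk
    (F := fun j z κ => linCovIter L (1 : Site d → Fin d → ℂˣ) (iEta η φ) j z κ) h2

#print axioms exists_B0_ineq159Flat_perCube_γ

end Literature.MathematicalPhysics.QuantumFieldTheory.Balaban1983to89.B8Ineq159FlatCubeMemberPerCubeGamma

end
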